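import Summits.Ventures.YMGap.YM4Door.StripCells

/-!
# YM4Door / WilsonPrice — THE BASIN IN BAŁABAN'S CURRENCY: the Wilson part priced on the load axes (`WilsonPrice.wilsonMember`, certified
# loads `(24e^κ|c|, 72√2·e^κ|c|)`), law relabelling, `SU2.clustersWith_of_smallWilson`, the Wilson-priced strip door `SU2.GibbsFormAtStripBasin`

HONEST FRAMING (cell `ym-beyond`, seat P2 «strong-coupling bridge», HUMAN RULING D-0035 / D-0037; g8 tree edition, 2026-08-25, split into
≤ 400-line modules for the gate; memo `HOME/ROUTE-P2.md` v0.8, spec `HOME/ROUTE-P2-LIFT-SPEC.md` v2).  LATTICE / finite-torus bookkeeping only: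
nothing here is a continuum, spectral or Clay-sense statement; nothing here moves the weak-coupling exit of Track A (uncertified); nothing
here is a part of Bałaban's theorems; NO effective action is asserted to be at any door.  NO conjecture name, NO `sorry`, NO axiom beyond
the standard three; label K = kernel bookkeeping.

Continuation of `YM4Door/StripDoor.lean` / `StripCells.lean` (§8 of the one text): namespace `WilsonPrice` (the one-plaquette Wilson function, its
oscillation and Lipschitz loads, `wilsonMember` ∈ `ClusterDomainFR` / `ClusterDomain`, the weight / perturbed-measure relabelling identities,
`inBall_add_wilsonMember`) and `SU2.{clustersWith_of_law_eq, inBall_relabel, law_relabel, clustersWith_of_smallWilson, exp_hundredth_le,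
clustersWith_of_strip_smallWilson, clustersWith_of_strip_milli, GibbsFormAtStripBasin, blockClusters_of_gibbsFormAtStripBasin, gibbsFormAtStripBasin_of_haarDoor}`.
References: as in `StripDoor.lean`; memo `HOME/ROUTE-P2.md` §2.5, §4c, §4e.
-/

noncomputable section

open MeasureTheory Finset Function Metric
open scoped Matrix.Norms.Frobenius
open Literature.Probability.LatticeModels Literature.Probability.LatticeModels.DobrushinMetric
open Literature.MathematicalPhysics.QuantumLattice hiding torusNorm configShift
open Literature.MathematicalPhysics.QuantumFieldTheory hiding ZdEdge
open Summit.Ventures.YMGap.RobustBall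
open Summit.Ventures.YMGap.StarResolventDim (Delta gaugeR doorPoly)
open Summit.Ventures.YMGap.YM3IR.ReceiverWitness

namespace Summit.Ventures.YMGap.YM4Door

variable {d L N : ℕ} [NeZero L]

/-! ## §8 (g6)  THE BASIN IN BAŁABAN'S CURRENCY: the Wilson-priced strip door (g5 NEXT (2))

g4's kernel-checked price of the β-axis (first certified in HOME `ROUTE-P2-SketchDoor.lean` §5, g4; below): the Wilson part `c·S_W` is a
ball member with certified loads `(24 e^κ |c|, 72√2 e^κ |c|)` (`SU(2)`, `d = 4`), so a Gibbs form `β S_W + W` is, as a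
LAW, the Gibbs form `0·S_W + (W + P_β)` and the Haar cell applies as soon as the Lipschitz budget `1/3` absorbs both
`W`'s load and the price of `β`.  Composed with §3: the strip door of the BASIN is one inequality in `(η/(δr), |β|)`. -/

namespace WilsonPrice

/-- `wilsonPlaqFn N c U = c · (N − Re tr U)` on `SU(N)`. [folklore] -/
def wilsonPlaqFn (N : ℕ) (c : ℝ) : SUN N → ℝ :=
  fun x => c * ((N : ℝ) - (x : Matrix (Fin N) (Fin N) ℂ).trace.re)

variable (N) (c : ℝ)

/-- The one-plaquette Wilson function is continuous. -/
theorem continuous_wilsonPlaqFn : Continuous (wilsonPlaqFn N c) :=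
  continuous_const.mul (continuous_const.sub continuous_re_trace_su)

/-- The one-plaquette Wilson function is a class function. -/
theorem wilsonPlaqFn_conj (g h : SUN N) : wilsonPlaqFn N c (h * g * h⁻¹) = wilsonPlaqFn N c g := by
  unfold wilsonPlaqFn
  have htr : ((h * g * h⁻¹ : SUN N) : Matrix (Fin N) (Fin N) ℂ).trace =
      (g : Matrix (Fin N) (Fin N) ℂ).trace := by
    rw [Submonoid.coe_mul, Submonoid.coe_mul, Matrix.trace_mul_cycle, ← Submonoid.coe_mul, inv_mul_cancel,
      OneMemClass.coe_one, one_mul]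
  rw [htr]

/-- Difference of two values of the one-plaquette Wilson function. -/
theorem wilsonPlaqFn_sub (x y : SUN N) : wilsonPlaqFn N c x - wilsonPlaqFn N c y =
    c * ((y : Matrix (Fin N) (Fin N) ℂ).trace.re - (x : Matrix (Fin N) (Fin N) ℂ).trace.re) := by
  unfold wilsonPlaqFn; ring

/-- Oscillation `≤ 2N|c|` (`|Re tr U| ≤ N` on `SU(N)`). [folklore] -/
theorem abs_wilsonPlaqFn_sub_le (x y : SUN N) :
    |wilsonPlaqFn N c x - wilsonPlaqFn N c y| ≤ 2 * N * |c| := by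
  rw [wilsonPlaqFn_sub, abs_mul]
  have h : |(y : Matrix (Fin N) (Fin N) ℂ).trace.re - (x : Matrix (Fin N) (Fin N) ℂ).trace.re| ≤ N + N :=
    (abs_sub _ _).trans (add_le_add (abs_re_trace_su_le y) (abs_re_trace_su_le x))
  calc |c| * |(y : Matrix (Fin N) (Fin N) ℂ).trace.re - (x : Matrix (Fin N) (Fin N) ℂ).trace.re|
      ≤ |c| * (N + N) := mul_le_mul_of_nonneg_left h (abs_nonneg c)
    _ = 2 * N * |c| := by ring

/-- Oscillation bound `2N|c|` for the one-plaquette Wilson function. -/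
theorem wilsonPlaqFn_osc (x y : SUN N) : wilsonPlaqFn N c x - wilsonPlaqFn N c y ≤ 2 * N * |c| :=
  (le_abs_self _).trans (abs_wilsonPlaqFn_sub_le N c x y)

/-- Frobenius-Lipschitz constant `√N |c|` (rb's `abs_re_trace_sub_le_suFrobDist`). [folklore] -/
theorem wilsonPlaqFn_lip (x y : SUN N) :
    |wilsonPlaqFn N c x - wilsonPlaqFn N c y| ≤ Real.sqrt N * |c| * suFrobDist x y := by
  rw [wilsonPlaqFn_sub, abs_mul, abs_sub_comm]
  calc |c| * |(x : Matrix (Fin N) (Fin N) ℂ).trace.re - (y : Matrix (Fin N) (Fin N) ℂ).trace.re|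
      ≤ |c| * (Real.sqrt N * suFrobDist x y) :=
        mul_le_mul_of_nonneg_left (abs_re_trace_sub_le_suFrobDist x y) (abs_nonneg c)
    _ = Real.sqrt N * |c| * suFrobDist x y := by ring

variable (d L)

/-- **`wilsonMember d L N c`**: rb's plaquette member (`PlaquetteMember.plaqFamily`) for the class function
`c · (N − Re tr U)`, oscillation constant `2N|c|`, Lipschitz constant `√N|c|`. [folklore] -/
def wilsonMember : Perturbation d L N :=
  termPerturbation (plaqFamily d L (wilsonPlaqFn N c) (2 * N * |c|) (Real.sqrt N * |c|)
    (continuous_wilsonPlaqFn N c) (wilsonPlaqFn_conj N c) (wilsonPlaqFn_osc N c) (by positivity)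
    (wilsonPlaqFn_lip N c))

/-- Its total is `c · S_W` for the fundamental representation. [folklore] -/
theorem total_wilsonMember (U : GaugeConfig d L (SUN N)) :
    (wilsonMember d L N c).total U = c * wilsonAction (fundamentalRep (Fin N)) U := by
  rw [wilsonMember, isPlaquetteAction_plaqFamily (wilsonPlaqFn N c) (2 * N * |c|) (Real.sqrt N * |c|)
    (continuous_wilsonPlaqFn N c) (wilsonPlaqFn_conj N c) (wilsonPlaqFn_osc N c) (by positivity)
    (wilsonPlaqFn_lip N c) U, wilsonAction, mul_sum]
  rfl

/-- Tier 1: `P_c ∈ ClusterDomainFR (2(d−1)·2N|c|) (6d(d−1)·√N|c|) 1` (tree `plaqFamily_mem_clusterDomainFR`). [folklore] -/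
theorem wilsonMember_mem_clusterDomainFR :
    wilsonMember d L N c ∈ ClusterDomainFR (2 * ((d : ℝ) - 1) * (2 * N * |c|))
      (6 * (d : ℝ) * ((d : ℝ) - 1) * (Real.sqrt N * |c|)) 1 :=
  plaqFamily_mem_clusterDomainFR (wilsonPlaqFn N c) (2 * N * |c|) (Real.sqrt N * |c|)
    (continuous_wilsonPlaqFn N c) (wilsonPlaqFn_conj N c) (wilsonPlaqFn_osc N c) (by positivity)
    (wilsonPlaqFn_lip N c)

/-- Tier 2: `P_c ∈ ClusterDomain κ (e^κ · 2(d−1) · 2N|c|) (e^κ · 6d(d−1) · √N|c|)` for `κ ≥ 0`. [folklore] -/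
theorem wilsonMember_mem_clusterDomain {κ : ℝ} (hκ : 0 ≤ κ) :
    wilsonMember d L N c ∈ ClusterDomain κ (Real.exp κ * (2 * ((d : ℝ) - 1) * (2 * N * |c|)))
      (Real.exp κ * (6 * (d : ℝ) * ((d : ℝ) - 1) * (Real.sqrt N * |c|))) :=
  clusterDomainFR_subset_clusterDomain hκ (by rw [Nat.cast_one, mul_one]) (by rw [Nat.cast_one, mul_one])
    (wilsonMember_mem_clusterDomainFR d L N c)

/-- Adding `P_c` shifts the coupling in the WEIGHT. [folklore] -/
theorem weight_add_wilsonMember (W : Perturbation d L N) (β : ℝ) :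
    (W + wilsonMember d L N c).weight (fundamentalRep (Fin N)) β = W.weight (fundamentalRep (Fin N)) (β + c) := by
  have hP : (wilsonMember d L N c).total = fun U => c * wilsonAction (fundamentalRep (Fin N)) U :=
    funext (total_wilsonMember d L N c)
  have h : (W + wilsonMember d L N c).total =
      fun U => W.total U + c * wilsonAction (fundamentalRep (Fin N)) U := by
    rw [QuasiLocalGaugePerturbation.total_add, hP]
    rfl
  simp only [QuasiLocalGaugePerturbation.weight, h]
  congr 1
  funext U
  rw [show -β * wilsonAction (fundamentalRep (Fin N)) U - (W.total U + c * wilsonAction (fundamentalRep (Fin N)) U) =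
    -(β + c) * wilsonAction (fundamentalRep (Fin N)) U - W.total U by ring]

/-- **Coupling shift**: `μ_{β, W + P_c} = μ_{β + c, W}`. [folklore] -/
theorem perturbedMeasure_add_wilsonMember (W : Perturbation d L N) (β : ℝ) :
    (W + wilsonMember d L N c).perturbedMeasure (fundamentalRep (Fin N)) β =
      W.perturbedMeasure (fundamentalRep (Fin N)) (β + c) := by
  simp only [QuasiLocalGaugePerturbation.perturbedMeasure, QuasiLocalGaugePerturbation.partitionFunction,
    weight_add_wilsonMember]

variable {d L N c}

/-- **RELABELLING COSTS RADIUS**: a member of `InBall κ ε₀ ε₁` at coupling `β + c` is, as a LAW, a member of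
`InBall κ (ε₀ + e^κ·2(d−1)·2N|c|) (ε₁ + e^κ·6d(d−1)·√N|c|)` at coupling `β`. [folklore] -/
theorem inBall_add_wilsonMember {κ ε₀ ε₁ : ℝ} (hκ : 0 ≤ κ) {W : Perturbation d L N} (hW : InBall κ ε₀ ε₁ W) (c : ℝ) :
    InBall κ (ε₀ + Real.exp κ * (2 * ((d : ℝ) - 1) * (2 * N * |c|)))
      (ε₁ + Real.exp κ * (6 * (d : ℝ) * ((d : ℝ) - 1) * (Real.sqrt N * |c|))) (W + wilsonMember d L N c) :=
  inBall_add hW (wilsonMember_mem_clusterDomain d L N c hκ)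

end WilsonPrice

namespace SU2

open WilsonPrice

/-- `ClustersWith` is a property of the LAW `μ_{β,W,L}` only: transport along an equality of perturbed measures (g4). -/
theorem clustersWith_of_law_eq {W W' : Perturbation 4 L 2} {β β' A m : ℝ}
    (h : W'.perturbedMeasure (fundamentalRep (Fin 2)) β' = W.perturbedMeasure (fundamentalRep (Fin 2)) β)
    (hW' : ClustersWith W' β' A m) : ClustersWith W β A m := by
  intro f g Δf Δg δf δg n hf hg hdf hdg hbf hbg hlf hlg hsep
  have hc := hW' f g Δf Δg δf δg n hf hg hdf hdg hbf hbg hlf hlg hsep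
  rwa [h] at hc

/-- **SU(2), d = 4: the certified Wilson loads** (g4) — relabelling `c` units of coupling into the perturbation costs
oscillation radius `24 e^κ |c|` and Lipschitz radius `72√2 e^κ |c|` (`≈ 24.24|c|`, `≈ 102.85|c|` at `κ = 1/100`). -/
theorem inBall_relabel {κ ε₀ ε₁ : ℝ} (hκ : 0 ≤ κ) {W : Perturbation 4 L 2} (hW : InBall κ ε₀ ε₁ W) (c : ℝ) :
    InBall κ (ε₀ + Real.exp κ * (24 * |c|)) (ε₁ + Real.exp κ * (72 * Real.sqrt 2 * |c|))
      (W + wilsonMember 4 L 2 c) := by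
  have h := inBall_add_wilsonMember (d := 4) (N := 2) hκ hW c
  refine clusterDomain_mono le_rfl (le_of_eq ?_) (le_of_eq ?_) h
  · push_cast; ring
  · push_cast; ring

/-- The relabelled member has the SAME law at coupling ZERO: `μ_{0, W + P_β} = μ_{β, W}` (g4). -/
theorem law_relabel (W : Perturbation 4 L 2) (β : ℝ) :
    (W + wilsonMember 4 L 2 β).perturbedMeasure (fundamentalRep (Fin 2)) 0 =
      W.perturbedMeasure (fundamentalRep (Fin 2)) β := by
  rw [perturbedMeasure_add_wilsonMember, zero_add]

/-- **THE HAAR BASIN WITH THE COUPLING INSIDE** (g4, hypothesis-free): on every torus `L ≥ 3`, every SU(2) Gibbs form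
`β S_W + W` with `W ∈ InBall κ ε₀ ε₁` (`κ ≥ 1/100`, `ε₀ ≥ 0` FREE) and `ε₁ + 72√2·e^κ·|β| ≤ 1/3` clusters at
`(16 e^{1/50}, 1/100)` — ANY SIGN of `β`. -/
theorem clustersWith_of_smallWilson {κ ε₀ ε₁ : ℝ} (hκ : 1 / 100 ≤ κ) (hε₀ : 0 ≤ ε₀) (hL : 3 ≤ L)
    {W : Perturbation 4 L 2} (hW : InBall κ ε₀ ε₁ W) {β : ℝ}
    (hsmall : ε₁ + Real.exp κ * (72 * Real.sqrt 2 * |β|) ≤ 1 / 3) :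
    ClustersWith W β (16 * Real.exp (1 / 50)) (1 / 100) := by
  have hκ0 : 0 ≤ κ := le_trans (by norm_num) hκ
  have hε₀' : 0 ≤ ε₀ + Real.exp κ * (24 * |β|) := by positivity
  have hmem : InBall κ (ε₀ + Real.exp κ * (24 * |β|)) (1 / 3) (W + wilsonMember 4 L 2 β) :=
    clusterDomain_mono le_rfl le_rfl hsmall (inBall_relabel hκ0 hW β)
  exact clustersWith_of_law_eq (law_relabel W β)
    (su2_torusClusteringOnBallW_star_haar_t100 κ hκ _ hε₀' L hL _ hmem)

/-- Numeric bound `e^{1/100} ≤ 1.01006`. -/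
theorem exp_hundredth_le : Real.exp (1 / 100) ≤ 1.01006 := by
  have h := Real.exp_bound' (x := (1 / 100 : ℝ)) (by norm_num) (by norm_num) (n := 3) (by norm_num)
  simp only [Finset.sum_range_succ, Finset.sum_range_zero, Nat.factorial] at h
  norm_num at h
  linarith

/-- ★ **THE BASIN IN BAŁABAN'S CURRENCY (the Wilson-priced strip door; g5 NEXT (2)).**  A perturbation in strip format
`(r, κ, η)` with thin supports and `κ ≥ 1/100 + δ`, at an effective coupling `β` OF EITHER SIGN, clusters at
`(16 e^{1/50}, 1/100)` on every torus `L ≥ 3` as soon as `8η/(e·δ·r) + e^{1/100}·72√2·|β| ≤ 1/3`: §3 puts `W` in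
`InBall (1/100) (2η) (8η/(eδr))`, g4's relabelling moves `β S_W` inside at Lipschitz price `72√2 e^{1/100} |β| ≈ 102.85|β|`,
the Haar cell closes.  Nothing is asked of the oscillation axis. -/
theorem clustersWith_of_strip_smallWilson (hL : 3 ≤ L) (W : Perturbation 4 L 2) {r κ η δ β : ℝ} (hr : 0 < r)
    (hW : W.HasAnalyticNormLE (fundamentalRep (Fin 2)) (fun _ => stripDomain (fundamentalRep (Fin 2)) r) κ η)
    (hsupp : ∀ X, W.act X ≠ 0 → (polymerDiam X : ℝ) ≤ (X.card : ℝ) - 1)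
    (hδ : 0 < δ) (hκ : 1 / 100 + δ ≤ κ)
    (hsmall : 8 / (Real.exp 1 * δ * r) * η + Real.exp (1 / 100) * (72 * Real.sqrt 2 * |β|) ≤ 1 / 3) :
    ClustersWith W β (16 * Real.exp (1 / 50)) (1 / 100) := by
  have hη := eta_nonneg_of_hasAnalyticNormLE_strip W hr hW
  have hmem : InBall (1 / 100) (2 * η) (2 * ((4 : ℕ) : ℝ) / (Real.exp 1 * δ * r) * η) W :=
    mem_clusterDomain_of_hasAnalyticNormLE_strip W hr hW hsupp (by norm_num) hδ hκ
  have e : (2 : ℝ) * ((4 : ℕ) : ℝ) = 8 := by norm_num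
  rw [e] at hmem
  exact clustersWith_of_smallWilson le_rfl (by positivity) hL hmem hsmall

/-- **Numeric row of the basin**: effective coupling `|β| ≤ 10⁻³` (tree units; `|β_W| ≤ 2·10⁻³`) and `8η/(eδr) ≤ 23/100`
(`η ≤ 0.0782·δr`) suffice (`0.23 + 102.85·10⁻³ ≈ 0.3329 ≤ 1/3`). -/
theorem clustersWith_of_strip_milli (hL : 3 ≤ L) (W : Perturbation 4 L 2) {r κ η δ β : ℝ} (hr : 0 < r)
    (hW : W.HasAnalyticNormLE (fundamentalRep (Fin 2)) (fun _ => stripDomain (fundamentalRep (Fin 2)) r) κ η)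
    (hsupp : ∀ X, W.act X ≠ 0 → (polymerDiam X : ℝ) ≤ (X.card : ℝ) - 1)
    (hδ : 0 < δ) (hκ : 1 / 100 + δ ≤ κ) (h₁ : 8 / (Real.exp 1 * δ * r) * η ≤ 23 / 100) (hβ : |β| ≤ 1 / 1000) :
    ClustersWith W β (16 * Real.exp (1 / 50)) (1 / 100) := by
  refine clustersWith_of_strip_smallWilson hL W hr hW hsupp hδ hκ ?_
  have h2 : Real.exp (1 / 100) * (72 * Real.sqrt 2 * |β|) ≤ 1.01006 * (72 * 1.41422 * (1 / 1000)) := by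
    apply mul_le_mul exp_hundredth_le _ (by positivity) (by norm_num)
    apply mul_le_mul _ hβ (abs_nonneg β) (by positivity)
    exact mul_le_mul_of_nonneg_left sqrt_two_le (by norm_num)
  linarith

variable {b S : ℕ} [NeZero b] [NeZero S]

/-- ★ **H-b″: «GIBBS FORM AT THE STRIP BASIN».**  The blocked fine Wilson law is the Gibbs law of a Bałaban effective action
whose terms are in strip format `(r, κ, B₀)` with thin supports, `κ ≥ 1/100 + δ`, and whose effective coupling — of either
sign, NOT confined to a cell — is paid for on the Lipschitz axis: `8B₀/(eδr) + e^{1/100}·72√2·|β_eff| ≤ 1/3`. -/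
@[folklore] def GibbsFormAtStripBasin (B : GaugeBlockAveraging 4 (SUN 2) b S) (β : ℝ) : Prop :=
  ∃ 𝓔 : BalabanEffectiveAction 4 S (SUN 2) 1, IsBalabanEffectiveActionOf ρ2 B β 𝓔 ∧
    ∃ r κ B₀ δ : ℝ, 0 < r ∧ 0 < δ ∧ 1 / 100 + δ ≤ κ ∧ InStripFormat 𝓔 r κ B₀ ∧
      8 / (Real.exp 1 * δ * r) * B₀ + Real.exp (1 / 100) * (72 * Real.sqrt 2 * |𝓔.β|) ≤ 1 / 3

/-- ★ **Strip basin ⇒ block-level IR.** -/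
theorem blockClusters_of_gibbsFormAtStripBasin (hS : 3 ≤ S) {B : GaugeBlockAveraging 4 (SUN 2) b S} {β : ℝ}
    (h : GibbsFormAtStripBasin B β) : BlockClusters B β (16 * Real.exp (1 / 50)) (1 / 100) := by
  obtain ⟨𝓔, h𝓔, r, κ, B₀, δ, hr, hδ, hκ, hF, hsmall⟩ := h
  exact ⟨𝓔, h𝓔, clustersWith_of_strip_smallWilson hS 𝓔.terms hr hF.1 hF.2 hδ hκ hsmall⟩

/-- The strip door of the Haar cell (§5, `GibbsFormAtStripDoor B β 0 ε₀ (1/3)`) is the basin's centre. -/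
theorem gibbsFormAtStripBasin_of_haarDoor {B : GaugeBlockAveraging 4 (SUN 2) b S} {β ε₀ : ℝ}
    (h : GibbsFormAtStripDoor B β 0 ε₀ (1 / 3)) : GibbsFormAtStripBasin B β := by
  obtain ⟨𝓔, h𝓔, hβ0, hβ, r, κ, B₀, δ, hr, hδ, hκ, hF, h₀, h₁⟩ := h
  refine ⟨𝓔, h𝓔, r, κ, B₀, δ, hr, hδ, hκ, hF, ?_⟩
  have hz : 𝓔.β = 0 := le_antisymm hβ hβ0
  rw [hz, abs_zero, mul_zero, mul_zero, add_zero]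
  exact h₁

end SU2

end Summit.Ventures.YMGap.YM4Door

end
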